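/-
Copyright: lit-balaban Phase-2 proof seat p30 (gen 5).  Statement-level skeleton of a published paper; no proof claims beyond what
the kernel checks below.
-/
import Literature.MathematicalPhysics.QuantumFieldTheory.BalabanImbrieJaffe1984to88.BIJ85Sigma421Torus
import Literature.MathematicalPhysics.QuantumFieldTheory.BalabanImbrieJaffe1984to88.BIJ85NoZeroModes309Torus

/-!
# `BalabanImbrieJaffe1984to88.BIJ85SigmaTorusScaling` — T. Bałaban, J. Imbrie, A. Jaffe, *Renormalization of the Higgs model:
minimizers, propagators and the stability of mean field theory*, Commun. Math. Phys. **97** (1985) 299–329 [BalabanImbrieJaffe1985]: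
the SCALING BOOKKEEPING of Sect. 6.1 — *"the scaling 𝒮_L absorbs the factor L^{−d}"* (p. 319) — for the torus σ_k of (4.2.1)–(4.2.2)
(`BIJ85Sigma421Torus.sigmaTorus`): the form is independent of the curl normalization and homogeneous of degree one in the plaquette
weight `w = η^d`, so `L^{−d}⟨f, σ_{k+1}f⟩_{η}` IS `⟨f, σ_{k+1}f⟩_{η/L}`, the (k+1)-st step's own normalization

statement-level skeleton of published theorems with citation tags; proofs where landed; nothing here is a claim about the Yang–Mills mass gap

PDF held: `paper:balaban1985-cmp97-bij-higgs-minimizers` (journal page = PDF page + 298).  Pages read as images: pp. 310–311, 318–319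
[PDF 12–13, 20–21] (`run/shared/lean/pub/pub-balaban/t4/b2b-balaban-t4-lit2/renders/bij1985/…-p012,p013-x2.png`,
`HOME/lit-balaban-r15/pages/1985-cmp97-bij-higgs-minimizers-p020,p021-x2.png`).

CITATION HEADER (lean-in-tree rule).  Part of the lit-balaban TYPED SKELETON (HOME `run/shared/lean/pub/lit-balaban/`), Phase-2
seat p30 (gen 5), unit `lit-balaban-p30`; rows **C1.Eq6.1.1** (the 𝒮_L^{−1} bookkeeping of (6.1.1)) and **C1.Eq4.2.1-4.2.2** (σ_k on the
tori) of `HOME/SKELETON.md`; companion of `BIJ85Eq611Structural`/`BIJ85Eq611Torus` (this seat), which prove (6.1.1) in ONE η-lattice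
with the factor `l² = L^{−d}` explicit (as gen 1's `BIJ85Eq611Proof.eq611`).

THE PRINTED TEXT (p. 318–319 [PDF 20–21], verbatim): *"⟨f^{(k)}, σ_k f^{(k)}⟩ = 𝒮_L^{−1}⟨f^{(k+1)}, σ_{k+1} f^{(k+1)}⟩ + ⟨B, Δ_kB⟩.
(6.1.1) In other words, the quadratic form σ_k … can be decomposed into the sum of two independent forms: the (k+1)-step quadratic
form scaled to the L-lattice and the quadratic form for the fluctuation field B."*; *"where the scaling 𝒮_L absorbs the factor L^{−d}"*;
(4.2.1) p. 310: *"exp(−½⟨f, σ_kf⟩) = Z_{k,Ax}^{−1}∫𝒟Aδ(Q_kA)δ_{k,Ax}(A)exp(−½‖∂A − Q^{e*}_kf‖²)"* with the η-lattice norm (2.20)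
`‖g‖² = Σ_p η^d|g(p)|²` (`w = η^d` in seat p09's encoding: `curlOp w c = √w·∂_c`, `QesOp hd w k = √w·Q^{e*}_k`).

WHAT IS PROVED.  Abstract (p09's setting): the projection `∂G_{k,Ax}∂^*` (`BIJ85SigmaForm421.curlG`) does not change when the curl is
rescaled, `curlG V (a•D) = curlG V D` for `a ≠ 0` (`curlG_smul_eq` — it is the orthogonal projection onto `∂V`, characterised by p09's
`curlG_symm`/`curlG_apply_curl`/`curlG_mem_range`); hence `sigmaOp V (a•D) (b•Qes) = b²•sigmaOp V D Qes` (`sigmaOp_smul`).  Torus: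
`curlOp w c = (√w·c)•curlOp 1 1`, `QesOp hd w k = √w•QesOp hd 1 k`, so **`sigmaTorus hd w c k = w•sigmaTorus hd 1 1 k`** (`sigmaTorus_eq_smul`;
`w > 0`, `c ≠ 0`, standing range for the no-zero-modes claim of p. 309 = seat p33's `hD_holds`): the torus σ_k is INDEPENDENT of the curl
factor `c` (`sigmaTorus_indep_c`) and LINEAR in the weight `w = η^d` (`sigmaTorus_scale_w`, `inner_sigmaTorus_scale_w`).  Consequently the
printed bookkeeping: with `l² = L^{−d}` and `η′ = η/L`, `l²·⟨f, σ_{k+1}f⟩_{w = η^d} = ⟨f, σ_{k+1}f⟩_{w′ = η′^d}` (`scaling_absorbs`) — the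
right member of (6.1.1) in the normalization of the (k+1)-st step.  D-0026: theorems only, no new named fact.
Unit `lit-balaban-p30` (literature-prover-lit-balaban-p30-g5-0), 2026-08-21.
-/

open scoped BigOperators RealInnerProductSpace

namespace Literature.MathematicalPhysics.QuantumFieldTheory.BalabanImbrieJaffe1984to88.BIJ85SigmaTorusScaling

open Literature.MathematicalPhysics.QuantumFieldTheory.Balaban1983to89
open LatticeFieldCalculus BIJ85Eq531Inputs BIJ85AxialPropagator411 BIJ85AxialMinimizer413 BIJ85SigmaForm421 BIJ85Sigma421Torus
  BIJ85NoZeroModes309Torus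

noncomputable section

/-! ## 1. The projection `∂G_{k,Ax}∂^*` and σ_k under rescaling of `∂` and `Q^{e*}_k` (abstract) -/

section Abstract

variable {E F F' : Type*} [NormedAddCommGroup E] [InnerProductSpace ℝ E] [FiniteDimensional ℝ E]
  [NormedAddCommGroup F] [InnerProductSpace ℝ F] [FiniteDimensional ℝ F]
  [NormedAddCommGroup F'] [InnerProductSpace ℝ F'] [FiniteDimensional ℝ F']

omit [FiniteDimensional ℝ E] [FiniteDimensional ℝ F] in
/-- No zero modes of `∂` on `V` ⇒ none of `a•∂`, `a ≠ 0`. [cite: BalabanImbrieJaffe1985, §4.1 p.309] -/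
theorem noZeroModes_smul {V : Submodule ℝ E} {D : E →ₗ[ℝ] F} (hD : ∀ v : V, D (v : E) = 0 → v = 0) {a : ℝ} (ha : a ≠ 0) :
    ∀ v : V, (a • D) (v : E) = 0 → v = 0 := fun v hv => hD v (by simpa [ha] using hv)

/-- **`∂G_{k,Ax}∂^*` is unchanged by rescaling the curl** (p. 311: *"∂G_{k,Ax}∂^* is a projection operator"* — it is the orthogonal
projection onto `∂V`, and `(a∂)V = ∂V`): `curlG V (a•D) = curlG V D` for `a ≠ 0` (no zero modes). [cite: BalabanImbrieJaffe1985, §4.2 p.311] -/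
theorem curlG_smul_eq {V : Submodule ℝ E} {D : E →ₗ[ℝ] F} (hD : ∀ v : V, D (v : E) = 0 → v = 0) {a : ℝ} (ha : a ≠ 0) :
    curlG V (a • D) = curlG V D := by
  have hDa := noZeroModes_smul hD ha
  refine LinearMap.ext fun g => ?_
  -- both projections fix `∂V`
  have hfix : ∀ v : V, curlG V D (D (v : E)) = D (v : E) := fun v => curlG_apply_curl hD v
  have hfix' : ∀ v : V, curlG V (a • D) (D (v : E)) = D (v : E) := by
    intro v
    have h := curlG_apply_curl hDa v
    rw [LinearMap.smul_apply, map_smul] at h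
    exact smul_right_injective F ha h
  -- their difference at `g` lies in `∂V` …
  obtain ⟨v₁, h₁⟩ := curlG_mem_range V (a • D) g
  obtain ⟨v₂, h₂⟩ := curlG_mem_range V D g
  set x : F := curlG V (a • D) g - curlG V D g with hx
  have hxV : x = D (((a • v₁ - v₂ : V)) : E) := by
    rw [hx, h₁, h₂, LinearMap.smul_apply, Submodule.coe_sub, Submodule.coe_smul, map_sub, map_smul]
  -- … and is orthogonal to `∂V`
  have horth : ∀ v : V, ⟪x, D (v : E)⟫ = 0 := by
    intro v
    rw [hx, inner_sub_left, curlG_symm hDa, curlG_symm hD, hfix v, hfix' v, sub_self]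
  have h0 : ⟪x, x⟫ = 0 := by
    have h := horth (a • v₁ - v₂)
    rwa [← hxV] at h
  have hx0 : x = 0 := inner_self_eq_zero.1 h0
  rw [hx] at hx0
  exact sub_eq_zero.1 hx0

/-- **σ_k under rescaling**: `σ_k = Q^e_k(I − ∂G_{k,Ax}∂^*)Q^{e*}_k` with `∂ ↦ a∂` (`a ≠ 0`) and `Q^{e*}_k ↦ bQ^{e*}_k` becomes `b²σ_k`.
[cite: BalabanImbrieJaffe1985, (4.2.2) p.310] -/
theorem sigmaOp_smul {V : Submodule ℝ E} {D : E →ₗ[ℝ] F} (hD : ∀ v : V, D (v : E) = 0 → v = 0) {a : ℝ} (ha : a ≠ 0) (b : ℝ)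
    (Qes : F' →ₗ[ℝ] F) : sigmaOp V (a • D) (b • Qes) = b ^ 2 • sigmaOp V D Qes := by
  refine LinearMap.ext fun f => ?_
  apply ext_inner_left ℝ
  intro g
  simp only [sigmaOp, curlG_smul_eq hD ha, LinearMap.comp_apply, LinearMap.smul_apply, LinearMap.adjoint_inner_right,
    LinearMap.sub_apply, LinearMap.id_apply, map_smul, inner_sub_right, real_inner_smul_right]
  ring

end Abstract

/-! ## 2. The torus σ_k: independent of the curl factor, linear in the weight `w = η^d` -/

section Torus

variable {P : Params}

/-- `√w·∂_c = (√w·c)·∂_1`: the weighted curl of p09 is a multiple of the unit one. [cite: BalabanImbrieJaffe1985, (4.2.1) p.310] -/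
theorem curlOp_eq_smul (w c : ℝ) : curlOp (P := P) w c = (Real.sqrt w * c) • curlOp (P := P) 1 1 := by
  refine LinearMap.ext fun v => ?_
  ext p
  show Real.sqrt w * curl c ((toE P).symm v) p = (Real.sqrt w * c) * (Real.sqrt 1 * curl 1 ((toE P).symm v) p)
  simp only [curl, smul_eq_mul, Real.sqrt_one, one_mul]
  ring

/-- `√w·Q^{e*}_k = √w·(√1·Q^{e*}_k)`. [cite: BalabanImbrieJaffe1985, (4.2.1) p.310] -/
theorem QesOp_eq_smul (hd : 2 ≤ P.d) (w : ℝ) (k : ℕ) :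
    QesOp (P := P) hd w k = Real.sqrt w • QesOp (P := P) hd 1 k := by
  refine LinearMap.ext fun f => ?_
  ext p
  show QesOp (P := P) hd w k f p = Real.sqrt w * QesOp (P := P) hd 1 k f p
  rw [QesOp_apply, QesOp_apply, Real.sqrt_one, one_mul]

/-- **The torus σ_k is `w` times a fixed operator**: `sigmaTorus hd w c k = w•sigmaTorus hd 1 1 k` (`w = η^d > 0`, `c ≠ 0`; no zero modes
of p. 309 = seat p33's theorem, standing range). [cite: BalabanImbrieJaffe1985, (4.2.2) p.310] -/
theorem sigmaTorus_eq_smul (hd : 2 ≤ P.d) {k : ℕ} (hk : k ≤ P.m + P.K) {w : ℝ} (hw : 0 < w) {c : ℝ} (hc : c ≠ 0) :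
    sigmaTorus (P := P) hd w c k = w • sigmaTorus (P := P) hd 1 1 k := by
  have hD : ∀ v : V411 P k, curlOp (P := P) 1 1 (v : BondSpace P) = 0 → v = 0 :=
    noZeroModes_V411 one_pos 1 k (hD_holds hk one_ne_zero)
  have ha : Real.sqrt w * c ≠ 0 := mul_ne_zero (Real.sqrt_pos.2 hw).ne' hc
  unfold sigmaTorus
  rw [curlOp_eq_smul w c, QesOp_eq_smul hd w k, sigmaOp_smul hD ha, Real.sq_sqrt hw.le]

/-- **σ_k does not depend on the curl normalization** `c` (`c, c′ ≠ 0`). [cite: BalabanImbrieJaffe1985, (4.2.2) p.310] -/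
theorem sigmaTorus_indep_c (hd : 2 ≤ P.d) {k : ℕ} (hk : k ≤ P.m + P.K) {w : ℝ} (hw : 0 < w) {c c' : ℝ} (hc : c ≠ 0) (hc' : c' ≠ 0) :
    sigmaTorus (P := P) hd w c k = sigmaTorus (P := P) hd w c' k := by
  rw [sigmaTorus_eq_smul hd hk hw hc, sigmaTorus_eq_smul hd hk hw hc']

/-- **σ_k is linear in the weight**: `sigmaTorus hd (a·w) c k = a•sigmaTorus hd w c′ k` (`a, w > 0`). [cite: BalabanImbrieJaffe1985, (4.2.2) p.310] -/
theorem sigmaTorus_scale_w (hd : 2 ≤ P.d) {k : ℕ} (hk : k ≤ P.m + P.K) {a w : ℝ} (ha : 0 < a) (hw : 0 < w) {c c' : ℝ} (hc : c ≠ 0)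
    (hc' : c' ≠ 0) : sigmaTorus (P := P) hd (a * w) c k = a • sigmaTorus (P := P) hd w c' k := by
  rw [sigmaTorus_eq_smul hd hk (mul_pos ha hw) hc, sigmaTorus_eq_smul hd hk hw hc', smul_smul]

/-- The same for the forms: `⟨f, σ_k^{(a·w)}f⟩ = a·⟨f, σ_k^{(w)}f⟩`. [cite: BalabanImbrieJaffe1985, (4.2.1) p.310] -/
theorem inner_sigmaTorus_scale_w (hd : 2 ≤ P.d) {k : ℕ} (hk : k ≤ P.m + P.K) {a w : ℝ} (ha : 0 < a) (hw : 0 < w) {c c' : ℝ}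
    (hc : c ≠ 0) (hc' : c' ≠ 0) (f g : UnitPlaqSpace P k) :
    ⟪f, sigmaTorus (P := P) hd (a * w) c k g⟫ = a * ⟪f, sigmaTorus (P := P) hd w c' k g⟫ := by
  rw [sigmaTorus_scale_w hd hk ha hw hc hc', LinearMap.smul_apply, real_inner_smul_right]

/-- **"The scaling 𝒮_L absorbs the factor L^{−d}"** (p. 319): with `l² = L^{−d}` and the (k+1)-st step's weight `w′ = l²·w` (`η′ = η/L`,
`w′ = η′^d`), `l²·⟨f, σ_{k+1}f⟩_w = ⟨f, σ_{k+1}f⟩_{w′}` for the torus σ_{k+1} at any two curl normalizations — the right member of (6.1.1)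
read in the normalization of the next step. [cite: BalabanImbrieJaffe1985, (6.1.1) p.319] -/
theorem scaling_absorbs (hd : 2 ≤ P.d) {k : ℕ} (hk : k + 1 ≤ P.m + P.K) {w : ℝ} (hw : 0 < w) {c c' : ℝ} (hc : c ≠ 0) (hc' : c' ≠ 0)
    {l : ℝ} (hl : l ≠ 0) (f : UnitPlaqSpace P (k + 1)) :
    l ^ 2 * ⟪f, sigmaTorus (P := P) hd w c (k + 1) f⟫ = ⟪f, sigmaTorus (P := P) hd (l ^ 2 * w) c' (k + 1) f⟫ := by
  rw [inner_sigmaTorus_scale_w hd hk (pow_pos (abs_pos.2 hl) 2 |>.trans_eq (sq_abs l)) hw hc' hc]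

end Torus

end

end Literature.MathematicalPhysics.QuantumFieldTheory.BalabanImbrieJaffe1984to88.BIJ85SigmaTorusScaling
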